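import Literature.AlgebraicGeometry.Frobenioids.PadicFrobenioidTwistProofs
import Literature.AlgebraicGeometry.Frobenioids.PadicFrobenioidIsotropic
import HarnessLib

/-!
# Frobenioids II, Remark 1.2.2 under reading (R1): toolkit (proofs)

Mochizuki, *The geometry of Frobenioids II*, Kyushu J. Math. **62** (2008), §1, Remark 1.2.2, p. 10
[cite: MochizukiFrdII2008, Rmk 1.2.2 p.10]; [FrdI] Def. 2.3 (characteristic splittings), Thm. 5.2 (i).

PROOF-ONLY lemmas (abc-iut node `FrdII:Rmk1.2.2-R1`, towards abc-iut-L1-t4's `Datum.Rmk122UOfBijective` /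
`Datum.Rmk122TwistOfBijective`) on an absolutely primitive `p`-adic Frobenioid datum (`Λ = ℤ`):

* `exists_ιHom_eq_pow` / `primeUnit_pow_injective` — the DEGREE of `x ∈ Φ(A)`: `ι(x) = Div₀(p)^m` in
  `Φ₀^gp(A)` for a unique `m ∈ ℕ`;
* `exists_generator_Φ` — "`Φ(A) ≅ ℤ_{≥0}`": `Φ(A)` is generated by one element `g ≠ 0` with injective powers
  (monoprime + totally ordered by divisibility + degrees);
* `div_pow_of_mem`, `unit_pow_of_mem`, `associated_of_div_eq`, `div_eq_of_associated` — `O^▷(X)` and its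
  characteristic: two base-identity linear endomorphisms are associated iff they have the same zero divisor;
* `exists_mem_τ_div_eq`, `eq_of_mem_τ_of_div_eq`, `exists_isGeneratorOf_τ`, `div_isGenerator_of_isGeneratorOf`
  — for a characteristic splitting `τ` ([FrdI] Def. 2.3, abc-iut-L1-t2) and an (isotropic) object `X` over
  `A`: `τ(X) → Φ(A)`, `t ↦ Div(t)` is bijective, so `τ(X)` has a unique generator and its divisor generates `Φ(A)`;
* `exists_endo_comp_eq`, `unit_eq_of_comp_eq`, `endo_eq_of_comp_eq`, `comp_mul_eq` — "`O^▷(φ)`" for a linear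
  `φ : X → Y` ([FrdI] Prop. 2.2 (ii)(a)): `β ↦ α` with `β ∘ φ = φ ∘ α`, explicitly `u_α = B(Base φ)(u_β)`.
-/

namespace Literature.AlgebraicGeometry.Frobenioids

namespace PadicFrd

open CategoryTheory Opposite Function ValuativeRel

universe v u

namespace Datum

variable {D : Type u} [Category.{v} D] {p : ℕ} [Fact p.Prime] (d : Datum D p)

/-- `End.asHom` turns products into composites. [folklore] -/
private theorem asHom_mul' {X : d.frobenioid} (a b : End X) : End.asHom (a * b) = End.asHom b ≫ End.asHom a :=
  rfl

/-! ### Degrees in `Φ(A)` and the generator of `Φ(A)` -/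

/-- **Degree, existence**: for absolutely primitive `Φ`, every `x ∈ Φ(A)` has `ι(x) = Div₀(p)^m` in `Φ₀^gp(A)`
for some `m ∈ ℕ` (lift `x` to `u ∈ B(A)`, then `Div₀(u|_{K^×}) = Div₀(p^m)`, FrdII p. 10).
[cite: MochizukiFrdII2008, Thm 1.2 (v) p.10] -/
theorem exists_ιHom_eq_pow (hap : d.IsAbsolutelyPrimitive) (A : D) (x : d.Φ.obj (op A)) :
    ∃ m : ℕ, Algebra.GrothendieckGroup.of (d.ιHom A x) = divZeroHom (d.fld A) (d.primeUnit A) ^ m := by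
  obtain ⟨u, hu⟩ := d.divB_surjective_of_isAbsolutelyPrimitive hap A (Algebra.GrothendieckGroup.of x)
  let X : d.frobenioid := ModelFrobenioid.zeroObj d.Φ d.B d.divB A
  have he := d.unitEnd_mem_endSubmonoid X x u hu.symm
  obtain ⟨m, hm⟩ := d.exists_divZeroHom_resK_unit_eq hap he
  refine ⟨m, ?_⟩
  change divZeroHom (d.fld A) (d.resK A u) = divZeroHom (d.fld A) (d.primeUnit A ^ m) at hm
  rw [← MonGp.map_of, ← hu, ← d.divZeroHom_resK, hm, map_pow]

/-- **Degree, uniqueness**: `m ↦ Div₀(p)^m` is injective on `ℕ` (`Div₀(p)` is not torsion).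
[cite: MochizukiFrdII2008, Ex 1.1 (ii) p.8] -/
theorem primeUnit_pow_injective (A : D) :
    Injective fun m : ℕ => divZeroHom (d.fld A) (d.primeUnit A) ^ m := by
  intro a b h
  have h' : divZeroHom (d.fld A) (d.primeUnit A) ^ (a : ℤ) = divZeroHom (d.fld A) (d.primeUnit A) ^ (b : ℤ) := by
    rw [zpow_natCast, zpow_natCast]
    exact h
  exact_mod_cast d.divZeroHom_primeUnit_zpow_injective A h'

/-- **`Φ(A) ≅ ℤ_{≥0}`** for absolutely primitive `Φ` and `Λ = ℤ` ("`O^▷(A_D)^char = O^▷(A_D)/O^×(A_D) ≅ ℤ_{≥0}`",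
FrdII Rmk. 1.2.2): `Φ(A)` has a generator `g ≠ 0` — every element is a power of `g` and the powers of `g` are
distinct (monoprime ⇒ totally ordered by divisibility; take `g` of minimal positive degree).
[cite: MochizukiFrdII2008, Rmk 1.2.2 p.10] -/
theorem exists_generator_Φ (hap : d.IsAbsolutelyPrimitive) (A : D) :
    ∃ g : d.Φ.obj (op A), g ≠ 1 ∧ (∀ x : d.Φ.obj (op A), ∃ k : ℕ, x = g ^ k) ∧
      ∀ a b : ℕ, g ^ a = g ^ b → a = b := by
  classical
  haveI := isCancelMul_realification (OrdInt (d.fld A))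
  choose deg hdeg using d.exists_ιHom_eq_pow hap A
  have hinj := d.primeUnit_pow_injective A
  have hdeg_eq : ∀ (x : d.Φ.obj (op A)) (m : ℕ),
      Algebra.GrothendieckGroup.of (d.ιHom A x) = divZeroHom (d.fld A) (d.primeUnit A) ^ m → deg x = m :=
    fun x m h => hinj ((hdeg x).symm.trans h)
  have hdeg_mul : ∀ x y, deg (x * y) = deg x + deg y := fun x y =>
    hdeg_eq _ _ (by rw [map_mul, map_mul, hdeg, hdeg, pow_add])
  have hdeg_one : ∀ x, deg x = 0 ↔ x = 1 := fun x =>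
    ⟨fun h => by
      have h1 := hdeg x
      rw [h, pow_zero] at h1
      exact d.ιHom_injective A
        ((Algebra.GrothendieckGroup.of_injective (h1.trans (map_one _).symm)).trans (map_one _).symm),
     fun h => hdeg_eq _ _ (by rw [h, map_one, map_one, pow_zero])⟩
  obtain ⟨x₀, hx₀⟩ := d.exists_ne_one (op A)
  have hex : ∃ m, ∃ x : d.Φ.obj (op A), x ≠ 1 ∧ deg x = m := ⟨_, x₀, hx₀, rfl⟩
  obtain ⟨g, hg1, hge⟩ := Nat.find_spec hex
  have hmin : ∀ x : d.Φ.obj (op A), x ≠ 1 → Nat.find hex ≤ deg x :=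
    fun x hx => Nat.find_min' hex ⟨x, hx, rfl⟩
  have he0 : 0 < Nat.find hex :=
    Nat.pos_of_ne_zero fun h => hg1 ((hdeg_one g).mp (hge.trans h))
  refine ⟨g, hg1, ?_, ?_⟩
  · suffices H : ∀ (N : ℕ) (x : d.Φ.obj (op A)), deg x ≤ N → ∃ k : ℕ, x = g ^ k from
      fun x => H _ x le_rfl
    intro N
    induction N with
    | zero =>
      intro x hx
      exact ⟨0, by rw [pow_zero]; exact (hdeg_one x).mp (Nat.le_zero.mp hx)⟩
    | succ N IH =>
      intro x hx
      by_cases h1 : x = 1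
      · exact ⟨0, by rw [h1, pow_zero]⟩
      rcases (d.isMonoprime (op A)).dvd_or_dvd g x with ⟨c, hc⟩ | ⟨c, hc⟩
      · have h2 := hdeg_mul g c
        rw [← hc, hge] at h2
        obtain ⟨k, hk⟩ := IH c (by omega)
        exact ⟨k + 1, by rw [hc, hk, pow_succ']⟩
      · have h2 := hdeg_mul x c
        rw [← hc, hge] at h2
        have h3 := hmin x h1
        have hc0 : deg c = 0 := by omega
        rw [(hdeg_one c).mp hc0, mul_one] at hc
        exact ⟨1, by rw [pow_one, hc]⟩
  · have hdp : ∀ n : ℕ, deg (g ^ n) = n * Nat.find hex := fun n => by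
      induction n with
      | zero => rw [pow_zero, (hdeg_one 1).mpr rfl, zero_mul]
      | succ n ih => rw [pow_succ, hdeg_mul, ih, hge, Nat.succ_mul]
    intro a b h
    have h' := congrArg deg h
    simp only [hdp] at h'
    exact Nat.eq_of_mul_eq_mul_right he0 h'

/-! ### `O^▷(X)`: powers, divisors and the characteristic -/

/-- `Div(η^k) = Div(η)^k` in `O^▷(X)`. [cite: MochizukiFrdI2008, Thm. 5.2(i) p.100] -/
theorem div_pow_of_mem {X : d.frobenioid} {η : End X}
    (hη : η ∈ PreFrobenioid.endSubmonoid d.structureFunctor X) (k : ℕ) :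
    ModelFrobenioid.div (End.asHom (η ^ k)) = ModelFrobenioid.div (End.asHom η) ^ k := by
  induction k with
  | zero => rw [pow_zero, pow_zero]; rfl
  | succ k ih =>
    rw [pow_succ, asHom_mul', d.div_comp_of_mem (Submonoid.pow_mem _ hη k) hη, ih, pow_succ]

/-- `u_{η^k} = u_η^k` in `O^▷(X)`. [cite: MochizukiFrdI2008, Thm. 5.2(i) p.100] -/
theorem unit_pow_of_mem {X : d.frobenioid} {η : End X}
    (hη : η ∈ PreFrobenioid.endSubmonoid d.structureFunctor X) (k : ℕ) :
    ModelFrobenioid.unit (End.asHom (η ^ k)) = ModelFrobenioid.unit (End.asHom η) ^ k := by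
  induction k with
  | zero => rw [pow_zero, pow_zero]; rfl
  | succ k ih =>
    rw [pow_succ, asHom_mul', d.unit_comp_of_mem (Submonoid.pow_mem _ hη k) hη, ih, pow_succ]

/-- A unit of the monoid `O^▷(X)` has trivial zero divisor (`Φ(A)` is sharp).
[cite: MochizukiFrdII2008, Thm 1.2 (i) p.9] -/
theorem div_eq_one_of_isUnit {X : d.frobenioid} {w : PreFrobenioid.endSubmonoid d.structureFunctor X}
    (hw : IsUnit w) : ModelFrobenioid.div (End.asHom (w : End X)) = 1 := by
  haveI := (d.isMonoprime (op X.base)).isCancelMul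
  obtain ⟨w', hww'⟩ := hw.exists_right_inv
  have h' : End.asHom ((w' : PreFrobenioid.endSubmonoid d.structureFunctor X) : End X) ≫
      End.asHom ((w : PreFrobenioid.endSubmonoid d.structureFunctor X) : End X) = 𝟙 X := by
    rw [← asHom_mul', ← Submonoid.coe_mul, hww', Submonoid.coe_one]
    rfl
  have hz1 : ModelFrobenioid.div (End.asHom (w : End X)) * ModelFrobenioid.div (End.asHom (w' : End X)) = 1 := by
    rw [← d.div_comp_of_mem (e := End.asHom (w : End X)) (e' := End.asHom (w' : End X)) w.2 w'.2, h',
      ModelFrobenioid.div_id]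
  exact (d.isMonoprime (op X.base)).isSharp.1 _ (IsUnit.of_mul_eq_one _ hz1)

/-- Associated elements of `O^▷(X)` have the same zero divisor. [cite: MochizukiFrdI2008, Def. 2.3 p.47] -/
theorem div_eq_of_associated {X : d.frobenioid} {t t' : End X}
    (ht : t ∈ PreFrobenioid.endSubmonoid d.structureFunctor X)
    (ht' : t' ∈ PreFrobenioid.endSubmonoid d.structureFunctor X)
    (h : Associated (⟨t, ht⟩ : PreFrobenioid.endSubmonoid d.structureFunctor X) ⟨t', ht'⟩) :
    ModelFrobenioid.div (End.asHom t) = ModelFrobenioid.div (End.asHom t') := by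
  obtain ⟨w, hw⟩ := h
  have hw2 : End.asHom ((w : PreFrobenioid.endSubmonoid d.structureFunctor X) : End X) ≫ End.asHom t =
      End.asHom t' := by
    have hw1 := congrArg (fun s : PreFrobenioid.endSubmonoid d.structureFunctor X => End.asHom (s : End X)) hw
    simp only [Submonoid.coe_mul, asHom_mul'] at hw1
    exact hw1
  rw [← hw2, d.div_comp_of_mem ht (w : PreFrobenioid.endSubmonoid d.structureFunctor X).2,
    d.div_eq_one_of_isUnit w.isUnit, mul_one]

/-- **`O^▷(X)^char ≅ Φ(A)`**: two base-identity linear endomorphisms with the same zero divisor are associated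
in `O^▷(X)` — they differ by the unit `(1, id, 0, u_{t'} · u_t⁻¹)`. [cite: MochizukiFrdI2008, Def. 2.3 p.47] -/
theorem associated_of_div_eq {X : d.frobenioid} {t t' : End X}
    (ht : t ∈ PreFrobenioid.endSubmonoid d.structureFunctor X)
    (ht' : t' ∈ PreFrobenioid.endSubmonoid d.structureFunctor X)
    (h : ModelFrobenioid.div (End.asHom t) = ModelFrobenioid.div (End.asHom t')) :
    Associated (⟨t, ht⟩ : PreFrobenioid.endSubmonoid d.structureFunctor X) ⟨t', ht'⟩ := by
  obtain ⟨c, hc⟩ := d.isUnit_B (op X.base) (ModelFrobenioid.unit (End.asHom t))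
  obtain ⟨c', hc'⟩ := d.isUnit_B (op X.base) (ModelFrobenioid.unit (End.asHom t'))
  have hr := d.of_div_eq_divB_unit ht
  have hr' := d.of_div_eq_divB_unit ht'
  rw [← hc] at hr
  rw [← hc', ← h, hr] at hr'
  -- `hr' : Div_B(c) = Div_B(c')`
  have hq : ∀ q : (d.B.obj (op X.base))ˣ, Frobenioids.divB d.Φ d.B d.divB (op X.base) (q : d.B.obj (op X.base)) = 1 →
      Algebra.GrothendieckGroup.of (1 : d.Φ.obj (op X.base)) =
        Frobenioids.divB d.Φ d.B d.divB (op X.base) (q : d.B.obj (op X.base)) :=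
    fun q hq => by rw [map_one, hq]
  have hU : Units.map (Frobenioids.divB d.Φ d.B d.divB (op X.base)) c =
      Units.map (Frobenioids.divB d.Φ d.B d.divB (op X.base)) c' :=
    Units.ext (by rw [Units.coe_map, Units.coe_map]; exact hr')
  have h1 : Frobenioids.divB d.Φ d.B d.divB (op X.base) ((c' * c⁻¹ : (d.B.obj (op X.base))ˣ) : _) = 1 := by
    rw [← Units.coe_map, map_mul, map_inv, hU, mul_inv_cancel, Units.val_one]
  have h2 : Frobenioids.divB d.Φ d.B d.divB (op X.base) ((c * c'⁻¹ : (d.B.obj (op X.base))ˣ) : _) = 1 := by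
    rw [← Units.coe_map, map_mul, map_inv, hU, mul_inv_cancel, Units.val_one]
  let w : X ⟶ X := ModelFrobenioid.unitEnd X 1 ((c' * c⁻¹ : (d.B.obj (op X.base))ˣ) : _) (hq _ h1)
  let w' : X ⟶ X := ModelFrobenioid.unitEnd X 1 ((c * c'⁻¹ : (d.B.obj (op X.base))ˣ) : _) (hq _ h2)
  have hwm : End.of w ∈ PreFrobenioid.endSubmonoid d.structureFunctor X := d.unitEnd_mem_endSubmonoid X _ _ _
  have hw'm : End.of w' ∈ PreFrobenioid.endSubmonoid d.structureFunctor X := d.unitEnd_mem_endSubmonoid X _ _ _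
  have key : ∀ (q q' : (d.B.obj (op X.base))ˣ) (h₁) (h₂), q * q' = 1 →
      ModelFrobenioid.unitEnd X 1 (q' : d.B.obj (op X.base)) h₂ ≫ ModelFrobenioid.unitEnd X 1 (q : d.B.obj (op X.base)) h₁ = 𝟙 X :=
    fun q q' h₁ h₂ hqq => by
    refine ModelFrobenioid.hom_ext ?_ ?_ ?_ ?_
    · exact mul_one _
    · exact Category.id_comp _
    · change (d.Φ.map (𝟙 X.base).op).hom 1 * 1 ^ ((1 : ℕ+) : ℕ) = 1
      rw [map_one, one_pow, mul_one]
    · change (d.B.map (𝟙 X.base).op).hom (q : d.B.obj (op X.base)) * (q' : d.B.obj (op X.base)) ^ ((1 : ℕ+) : ℕ) = 1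
      rw [ModelFrobenioid.map_id_apply_B, PNat.one_coe, pow_one, ← Units.val_mul, hqq, Units.val_one]
  have hww' : (⟨End.of w, hwm⟩ : PreFrobenioid.endSubmonoid d.structureFunctor X) * ⟨End.of w', hw'm⟩ = 1 :=
    Subtype.ext (key (c' * c⁻¹) (c * c'⁻¹) (hq _ h1) (hq _ h2)
      (by rw [mul_assoc, inv_mul_cancel_left, mul_inv_cancel]))
  have hw'w : (⟨End.of w', hw'm⟩ : PreFrobenioid.endSubmonoid d.structureFunctor X) * ⟨End.of w, hwm⟩ = 1 :=
    Subtype.ext (key (c * c'⁻¹) (c' * c⁻¹) (hq _ h2) (hq _ h1)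
      (by rw [mul_assoc, inv_mul_cancel_left, mul_inv_cancel]))
  refine ⟨⟨⟨End.of w, hwm⟩, ⟨End.of w', hw'm⟩, hww', hw'w⟩, Subtype.ext ?_⟩
  -- `t · w = t'`, i.e. `w ≫ t = t'`
  change w ≫ End.asHom t = End.asHom t'
  have hd : ModelFrobenioid.degFr (End.asHom t) = 1 := ht.2
  have hd' : ModelFrobenioid.degFr (End.asHom t') = 1 := ht'.2
  have hb : ModelFrobenioid.baseMap (End.asHom t) = 𝟙 X.base := ht.1
  have hb' : ModelFrobenioid.baseMap (End.asHom t') = 𝟙 X.base := ht'.1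
  refine ModelFrobenioid.hom_ext ?_ ?_ ?_ ?_
  · rw [ModelFrobenioid.degFr_comp, hd, hd']
    exact mul_one _
  · rw [ModelFrobenioid.baseMap_comp, hb, hb']
    exact Category.id_comp _
  · rw [ModelFrobenioid.div_comp, hd, PNat.one_coe, pow_one, ← h]
    change (d.Φ.map (𝟙 X.base).op).hom (ModelFrobenioid.div (End.asHom t)) * 1 = _
    rw [ModelFrobenioid.map_id_apply_Φ, mul_one]
  · rw [ModelFrobenioid.unit_comp, hd, PNat.one_coe, pow_one]
    change (d.B.map (𝟙 X.base).op).hom (ModelFrobenioid.unit (End.asHom t)) *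
      ((c' * c⁻¹ : (d.B.obj (op X.base))ˣ) : _) = ModelFrobenioid.unit (End.asHom t')
    rw [ModelFrobenioid.map_id_apply_B, ← hc, ← hc', ← Units.val_mul, mul_comm, inv_mul_cancel_right]

/-! ### Characteristic splittings on the `p`-adic Frobenioid: `τ(X) ≅ Φ(A)` via `Div` -/

section Splitting

variable (T : PreFrobenioid.CharacteristicSplitting d.structureFunctor)

/-- `τ(X) ⊆ O^▷(X)` (every object of the `p`-adic Frobenioid is isotropic). [cite: MochizukiFrdI2008, Def. 2.3 p.47] -/
theorem τ_le' (X : d.frobenioid) : T.τ X ≤ PreFrobenioid.endSubmonoid d.structureFunctor X :=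
  T.τ_le (d.thm12_isIsotropic X)

/-- **Injectivity of `τ(X) → Φ(A)`**: elements of `τ(X)` with the same zero divisor coincide (they are
associated, and `τ(X) → O^▷(X)^char` is injective, [FrdI] Def. 2.3 (a)). [cite: MochizukiFrdI2008, Def. 2.3 p.47] -/
theorem eq_of_mem_τ_of_div_eq {X : d.frobenioid} {t t' : End X} (ht : t ∈ T.τ X) (ht' : t' ∈ T.τ X)
    (h : ModelFrobenioid.div (End.asHom t) = ModelFrobenioid.div (End.asHom t')) : t = t' := by
  have hinj := (T.bijective (d.thm12_isIsotropic X)).1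
  have key := @hinj ⟨t, ht⟩ ⟨t', ht'⟩ (Associates.mk_eq_mk_iff_associated.mpr
    (d.associated_of_div_eq (d.τ_le' T X ht) (d.τ_le' T X ht') h))
  exact congrArg Subtype.val key

/-- **Surjectivity of `τ(X) → Φ(A)`** (absolutely primitive `Φ`): every `x ∈ Φ(A)` is the zero divisor of an
element of `τ(X)` (`Div_B` is surjective, and `τ(X) → O^▷(X)^char` is surjective, [FrdI] Def. 2.3 (a)).
[cite: MochizukiFrdI2008, Def. 2.3 p.47] -/
theorem exists_mem_τ_div_eq (hap : d.IsAbsolutelyPrimitive) (X : d.frobenioid) (x : d.Φ.obj (op X.base)) :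
    ∃ t ∈ T.τ X, ModelFrobenioid.div (End.asHom t) = x := by
  obtain ⟨u, hu⟩ := d.divB_surjective_of_isAbsolutelyPrimitive hap X.base (Algebra.GrothendieckGroup.of x)
  let e : X ⟶ X := ModelFrobenioid.unitEnd X x u hu.symm
  have he : End.of e ∈ PreFrobenioid.endSubmonoid d.structureFunctor X := d.unitEnd_mem_endSubmonoid X _ _ _
  obtain ⟨⟨t, ht⟩, hte⟩ := (T.bijective (d.thm12_isIsotropic X)).2 (Associates.mk ⟨End.of e, he⟩)
  refine ⟨t, ht, ?_⟩
  have hassoc := Associates.mk_eq_mk_iff_associated.mp hte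
  exact d.div_eq_of_associated (d.τ_le' T X ht) he hassoc

/-- **`τ(X)` is cyclic**: it has a generator (the element whose zero divisor generates `Φ(A) ≅ ℤ_{≥0}`), and the
zero divisor of ANY generator of `τ(X)` generates `Φ(A)` with injective powers ("`η ∈ τ(A_D)` a generator of
`τ(A_D)`", FrdII Rmk. 1.2.2). [cite: MochizukiFrdII2008, Rmk 1.2.2 p.10] -/
theorem exists_isGeneratorOf_τ (hap : d.IsAbsolutelyPrimitive) (X : d.frobenioid) :
    ∃ η : End X, IsGeneratorOf η (T.τ X) := by
  obtain ⟨g, -, hgen, -⟩ := d.exists_generator_Φ hap X.base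
  obtain ⟨η, hη, hηg⟩ := d.exists_mem_τ_div_eq T hap X g
  refine ⟨η, hη, fun t ht => ?_⟩
  obtain ⟨k, hk⟩ := hgen (ModelFrobenioid.div (End.asHom t))
  exact ⟨k, d.eq_of_mem_τ_of_div_eq T ht (Submonoid.pow_mem _ hη k)
    (by rw [d.div_pow_of_mem (d.τ_le' T X hη), hηg, hk])⟩

/-- The zero divisor of a generator `η` of `τ(X)` generates `Φ(A)`: every `x ∈ Φ(A)` is `Div(η)^k`, and the powers
of `Div(η)` are distinct. [cite: MochizukiFrdII2008, Rmk 1.2.2 p.10] -/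
theorem div_isGenerator_of_isGeneratorOf (hap : d.IsAbsolutelyPrimitive) {X : d.frobenioid} {η : End X}
    (hη : IsGeneratorOf η (T.τ X)) :
    (∀ x : d.Φ.obj (op X.base), ∃ k : ℕ, x = ModelFrobenioid.div (End.asHom η) ^ k) ∧
      ∀ a b : ℕ, ModelFrobenioid.div (End.asHom η) ^ a = ModelFrobenioid.div (End.asHom η) ^ b → a = b := by
  obtain ⟨g, hg1, hgen, hginj⟩ := d.exists_generator_Φ hap X.base
  -- the element of `τ(X)` over `g` is a power `η^j` of the generator, and `Div(η) = g^i`: so `g = g^{ij}`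
  obtain ⟨t, ht, htg⟩ := d.exists_mem_τ_div_eq T hap X g
  obtain ⟨j, hj⟩ := hη.2 t ht
  obtain ⟨i, hi⟩ := hgen (ModelFrobenioid.div (End.asHom η))
  have hη1 := d.τ_le' T X hη.1
  have hij : g = g ^ (i * j) := by
    conv_lhs => rw [← htg, hj, d.div_pow_of_mem hη1, hi, ← pow_mul]
  have hij1 : i * j = 1 := (hginj 1 (i * j) (by rw [pow_one]; exact hij)).symm
  have hi1 : i = 1 := Nat.eq_one_of_mul_eq_one_right hij1
  rw [hi1, pow_one] at hi
  rw [hi]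
  exact ⟨hgen, hginj⟩

/-- Generators of `τ(X)` are unique. [cite: MochizukiFrdII2008, Rmk 1.2.2 p.10] -/
theorem isGeneratorOf_unique (hap : d.IsAbsolutelyPrimitive) {X : d.frobenioid} {η η' : End X}
    (hη : IsGeneratorOf η (T.τ X)) (hη' : IsGeneratorOf η' (T.τ X)) : η = η' := by
  obtain ⟨hgen, hginj⟩ := d.div_isGenerator_of_isGeneratorOf T hap hη
  obtain ⟨a, ha⟩ := hη.2 η' hη'.1
  obtain ⟨b, hb⟩ := hη'.2 η hη.1
  have hη1 := d.τ_le' T X hη.1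
  have hab : ModelFrobenioid.div (End.asHom η) ^ 1 = ModelFrobenioid.div (End.asHom η) ^ (a * b) := by
    rw [pow_one, pow_mul, ← d.div_pow_of_mem hη1 a, ← ha,
      ← d.div_pow_of_mem (d.τ_le' T X hη'.1) b, ← hb]
  have ha1 : a = 1 := Nat.eq_one_of_mul_eq_one_right (hginj _ _ hab).symm
  rw [ha, ha1, pow_one]

end Splitting

/-! ### `O^▷(φ)` for a linear morphism `φ` -/

/-- **`O^▷(φ)`, existence** ([FrdI] Prop. 2.2 (ii)(a)): for a linear `φ : X → Y` and `β ∈ O^▷(Y)`, the endomorphism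
`α := (1, id, Φ(Base φ)(Div β), B(Base φ)(u_β)) ∈ O^▷(X)` satisfies `β ∘ φ = φ ∘ α`.
[cite: MochizukiFrdI2008, Prop. 2.2 (ii) p.44] -/
theorem exists_endo_comp_eq {X Y : d.frobenioid} (φ : X ⟶ Y) (hφ : PreFrobenioid.IsLinear d.structureFunctor φ)
    {β : End Y} (hβ : β ∈ PreFrobenioid.endSubmonoid d.structureFunctor Y) :
    ∃ α ∈ PreFrobenioid.endSubmonoid d.structureFunctor X, φ ≫ End.asHom β = End.asHom α ≫ φ ∧
      ModelFrobenioid.unit (End.asHom α) =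
        (d.B.map (ModelFrobenioid.baseMap φ).op).hom (ModelFrobenioid.unit (End.asHom β)) ∧
      ModelFrobenioid.div (End.asHom α) =
        (d.Φ.map (ModelFrobenioid.baseMap φ).op).hom (ModelFrobenioid.div (End.asHom β)) := by
  have hβr := d.of_div_eq_divB_unit (e := End.asHom β) hβ
  have hdφ : ModelFrobenioid.degFr φ = 1 := hφ
  have hdβ : ModelFrobenioid.degFr (End.asHom β) = 1 := hβ.2
  have hbβ : ModelFrobenioid.baseMap (End.asHom β) = 𝟙 Y.base := hβ.1
  refine ⟨End.of (ModelFrobenioid.unitEnd X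
    ((d.Φ.map (ModelFrobenioid.baseMap φ).op).hom (ModelFrobenioid.div (End.asHom β)))
    ((d.B.map (ModelFrobenioid.baseMap φ).op).hom (ModelFrobenioid.unit (End.asHom β)))
    (ModelFrobenioid.of_map_eq_divB_map _ hβr)), d.unitEnd_mem_endSubmonoid X _ _ _,
    ModelFrobenioid.hom_ext ?_ ?_ ?_ ?_, rfl, rfl⟩
  · rw [ModelFrobenioid.degFr_comp, ModelFrobenioid.degFr_comp, hdβ, one_mul]
    exact (mul_one _).symm
  · rw [ModelFrobenioid.baseMap_comp, ModelFrobenioid.baseMap_comp, hbβ, Category.comp_id]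
    exact (Category.id_comp _).symm
  · rw [ModelFrobenioid.div_comp, ModelFrobenioid.div_comp, hdβ, hdφ, PNat.one_coe, pow_one, pow_one]
    change _ = (d.Φ.map (𝟙 X.base).op).hom (ModelFrobenioid.div φ) *
      (d.Φ.map (ModelFrobenioid.baseMap φ).op).hom (ModelFrobenioid.div (End.asHom β))
    rw [ModelFrobenioid.map_id_apply_Φ, mul_comm]
  · rw [ModelFrobenioid.unit_comp, ModelFrobenioid.unit_comp, hdβ, hdφ, PNat.one_coe, pow_one, pow_one]
    change _ = (d.B.map (𝟙 X.base).op).hom (ModelFrobenioid.unit φ) *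
      (d.B.map (ModelFrobenioid.baseMap φ).op).hom (ModelFrobenioid.unit (End.asHom β))
    rw [ModelFrobenioid.map_id_apply_B, mul_comm]

/-- **`O^▷(φ)`, the formula `u_α = B(Base φ)(u_β)`**: if `β ∘ φ = φ ∘ α` with `φ` linear, `β ∈ O^▷(Y)`, `α ∈ O^▷(X)`,
then the rational function of `α` is the pull-back of that of `β`. [cite: MochizukiFrdI2008, Prop. 2.2 (ii) p.44] -/
theorem unit_eq_of_comp_eq {X Y : d.frobenioid} (φ : X ⟶ Y) (hφ : PreFrobenioid.IsLinear d.structureFunctor φ)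
    {β : End Y} (hβ : β ∈ PreFrobenioid.endSubmonoid d.structureFunctor Y)
    {α : End X} (hα : α ∈ PreFrobenioid.endSubmonoid d.structureFunctor X)
    (h : φ ≫ End.asHom β = End.asHom α ≫ φ) :
    ModelFrobenioid.unit (End.asHom α) =
      (d.B.map (ModelFrobenioid.baseMap φ).op).hom (ModelFrobenioid.unit (End.asHom β)) := by
  have hu := congrArg ModelFrobenioid.unit h
  have hdφ : ModelFrobenioid.degFr φ = 1 := hφ
  have hdβ : ModelFrobenioid.degFr (End.asHom β) = 1 := hβ.2
  have hbα : ModelFrobenioid.baseMap (End.asHom α) = 𝟙 X.base := hα.1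
  rw [ModelFrobenioid.unit_comp, ModelFrobenioid.unit_comp, hdφ, hdβ, hbα, PNat.one_coe, pow_one,
    pow_one, ModelFrobenioid.map_id_apply_B,
    mul_comm (ModelFrobenioid.unit φ) (ModelFrobenioid.unit (End.asHom α))] at hu
  obtain ⟨c, hc⟩ := d.isUnit_B (op X.base) (ModelFrobenioid.unit φ)
  rw [← hc] at hu
  exact ((Units.mul_left_inj c).mp hu).symm

/-- **`O^▷(φ)` is well defined**: `α` with `β ∘ φ = φ ∘ α` is unique. [cite: MochizukiFrdI2008, Prop. 2.2 (ii) p.44] -/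
theorem endo_eq_of_comp_eq {X Y : d.frobenioid} (φ : X ⟶ Y) (hφ : PreFrobenioid.IsLinear d.structureFunctor φ)
    {β : End Y} (hβ : β ∈ PreFrobenioid.endSubmonoid d.structureFunctor Y)
    {α α' : End X} (hα : α ∈ PreFrobenioid.endSubmonoid d.structureFunctor X)
    (hα' : α' ∈ PreFrobenioid.endSubmonoid d.structureFunctor X)
    (h : φ ≫ End.asHom β = End.asHom α ≫ φ) (h' : φ ≫ End.asHom β = End.asHom α' ≫ φ) : α = α' :=
  d.eq_of_mem_of_unit_eq hα hα'
    ((d.unit_eq_of_comp_eq φ hφ hβ hα h).trans (d.unit_eq_of_comp_eq φ hφ hβ hα' h').symm)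

/-- **`O^▷(φ)` is multiplicative**: if `β₁ ∘ φ = φ ∘ α₁` and `β₂ ∘ φ = φ ∘ α₂` then
`(β₁ β₂) ∘ φ = φ ∘ (α₁ α₂)`. [cite: MochizukiFrdI2008, Prop. 2.2 (ii) p.44] -/
theorem comp_mul_eq {X Y : d.frobenioid} (φ : X ⟶ Y) {β₁ β₂ : End Y} {α₁ α₂ : End X}
    (h₁ : φ ≫ End.asHom β₁ = End.asHom α₁ ≫ φ) (h₂ : φ ≫ End.asHom β₂ = End.asHom α₂ ≫ φ) :
    φ ≫ End.asHom (β₁ * β₂) = End.asHom (α₁ * α₂) ≫ φ := by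
  rw [asHom_mul', asHom_mul', ← Category.assoc, h₂, Category.assoc, h₁, Category.assoc]

end Datum

end PadicFrd

end Literature.AlgebraicGeometry.Frobenioids
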